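import Summits.PneNP.PneNP.Theses.Circuit2
import Summits.PneNP.PneNP.Theses.Circuit
import Summits.PneNP.PneNP.Theorems.Circuit2CircuitMagnificationGlue
import Summits.PneNP.PneNP.Theorems.Circuit2CircuitMcspGlue
import Literature.Computability.Complexity.KarpLipton
import Literature.Computability.Complexity.PolyAdvicePH
import Literature.Computability.Complexity.StructuralPHProofs
import Literature.Computability.Complexity.ClayProblemProofs

/-!
# BC2 probes for crux `Circuit2.CircuitThesis` (stmt-PneNP-10624) — companion of STRATEGY-CENSUS.md §D.0

The instruction's cheap probe `first | exact? | simpa [piece] | (unfold piece; simpa) | aesop` (aesop in TERMINAL mode,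
so that a failed search is an error and `first` moves on), run on fifteen
implications `piece → S`, `piece → X`, `X → piece`, `S → X`.  SELF-CERTIFYING FORM: each probe ends in `| sorry`, so the
file elaborates and the number of `declaration uses 'sorry'` warnings reported by `lean check` EQUALS the number of probes
whose search tactics all failed.  Result (2026-08-17, farm): 15 examples, 15 sorry warnings — every probe FAILS, including
those for pieces that are ≥ X or ≡ X by LANDED theorems (P4–P8): the probes do not see through `def` wrappers, so probe
failure is necessary for criterion (c), not sufficient (see StrategyCensus.lean §3–§4 for the by-name test).
-/

set_option maxHeartbeats 400000

open Literature.Computability.Complexity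
open Summit.PneNP.PneNP.Theses

abbrev X : Prop := Circuit2.CircuitThesis

def FixedPolyAmplification : Prop :=
  Nondeterministic.NP ⊆ PPoly → ∃ k : ℕ, Nondeterministic.NP ⊆ ⋃ c : ℕ, SIZE (fun n => c * n ^ k + c)

-- P1: admissible piece CircuitFixedPoly
example : Circuit.CircuitFixedPoly → _root_.PneNP := by
  first | exact? | simpa [Circuit.CircuitFixedPoly] | (unfold Circuit.CircuitFixedPoly; simpa) | (aesop (config := { terminal := true, warnOnNonterminal := false })) | sorry
example : Circuit.CircuitFixedPoly → X := by
  first | exact? | simpa [Circuit.CircuitFixedPoly] | (unfold Circuit.CircuitFixedPoly; simpa) | (aesop (config := { terminal := true, warnOnNonterminal := false })) | sorry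
-- P2: its amplification partner
example : FixedPolyAmplification → _root_.PneNP := by
  first | exact? | simpa [FixedPolyAmplification] | (unfold FixedPolyAmplification; simpa) | (aesop (config := { terminal := true, warnOnNonterminal := false })) | sorry
example : FixedPolyAmplification → X := by
  first | exact? | simpa [FixedPolyAmplification] | (unfold FixedPolyAmplification; simpa) | (aesop (config := { terminal := true, warnOnNonterminal := false })) | sorry
-- P3: NP ⊄ TC0
example : Circuit.CircuitNpTc0 → X := by
  first | exact? | simpa [Circuit.CircuitNpTc0] | (unfold Circuit.CircuitNpTc0; simpa) | (aesop (config := { terminal := true, warnOnNonterminal := false })) | sorry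
example : Circuit.CircuitNpTc0 → _root_.PneNP := by
  first | exact? | simpa [Circuit.CircuitNpTc0] | (unfold Circuit.CircuitNpTc0; simpa) | (aesop (config := { terminal := true, warnOnNonterminal := false })) | sorry
-- P4: #2 MCSP ∉ P/poly (expected: may SUCCEED via the landed glue)
example : Circuit2.CircuitMcspNotPpoly → X := by
  first | exact? | simpa [Circuit2.CircuitMcspNotPpoly] | (unfold Circuit2.CircuitMcspNotPpoly; simpa) | (aesop (config := { terminal := true, warnOnNonterminal := false })) | sorry
-- P5: #5R (expected: may SUCCEED via the landed glue)
example : Circuit2.CircuitMagnificationFrontierR → X := by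
  first | exact? | simpa [Circuit2.CircuitMagnificationFrontierR] | (aesop (config := { terminal := true, warnOnNonterminal := false })) | sorry
-- P6: PH ≠ Σ₂
example : PH ≠ SigmaP 2 → X := by
  first | exact? | simpa | (aesop (config := { terminal := true, warnOnNonterminal := false })) | sorry
-- P7: PH ⊄ P/poly
example : ¬ (PH ⊆ PPoly) → X := by
  first | exact? | simpa | (aesop (config := { terminal := true, warnOnNonterminal := false })) | sorry
-- P8: SAT ∉ P/poly
example : SAT ∉ PPoly → X := by
  first | exact? | simpa | (aesop (config := { terminal := true, warnOnNonterminal := false })) | sorry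
-- P9: #4 NEXP
example : Circuit2.CircuitNexpNotPpoly → X := by
  first | exact? | simpa [Circuit2.CircuitNexpNotPpoly] | (aesop (config := { terminal := true, warnOnNonterminal := false })) | sorry
example : Circuit2.CircuitNexpNotPpoly → _root_.PneNP := by
  first | exact? | simpa [Circuit2.CircuitNexpNotPpoly] | (aesop (config := { terminal := true, warnOnNonterminal := false })) | sorry
-- converse probes S → piece / X → piece
example : X → Circuit.CircuitFixedPoly := by
  first | exact? | simpa | (aesop (config := { terminal := true, warnOnNonterminal := false })) | sorry
example : _root_.PneNP → X := by
  first | exact? | simpa | (aesop (config := { terminal := true, warnOnNonterminal := false })) | sorry
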